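import Mathlib

/-!
Triage r1-1, crux stmt-QuantumFields-11685 (ShellRigidity), card `rapidity-liouville-spin-cutoff`,
step (v) SIMPLIFIED: once the complex-angle function is `Φ_r(w) = a₀ + a₁ cos 4w` (σ < 8), the two
frame Laplace transforms are `L_A(r cosh χ, r sinh χ) = Φ_r(iχ) = a₀ + a₁ cosh 4χ ≥ 0` and
`L_{D'}(r cosh χ, r sinh χ) = Φ_r(π/4 − iχ) = a₀ − a₁ cosh 4χ ≥ 0` (Laplace transforms of POSITIVE
measures at real points of the forward cone). Positivity alone forces `a₁ = 0` — no boost-invariance /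
Radon–Nikodym / d'Alembert functional equation (the card's L4) is needed.
-/

theorem stepV_positivity (a₀ a₁ : ℝ)
    (hA : ∀ χ : ℝ, 0 ≤ a₀ + a₁ * Real.cosh (4 * χ))
    (hD : ∀ χ : ℝ, 0 ≤ a₀ - a₁ * Real.cosh (4 * χ)) : a₁ = 0 := by
  by_contra h
  have hpos : 0 < |a₁| := abs_pos.mpr h
  have key : ∀ χ : ℝ, |a₁| * Real.cosh (4 * χ) ≤ a₀ := by
    intro χ
    have h1 := hA χ
    have h2 := hD χ
    rcases le_or_gt 0 a₁ with ha | ha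
    · rw [abs_of_nonneg ha]; linarith
    · rw [abs_of_neg ha]; linarith
  have ha0 : 0 ≤ a₀ := by
    have := key 0
    have hc : 0 < Real.cosh (4 * 0) := Real.cosh_pos _
    nlinarith
  -- take χ := a₀ / |a₁| + 1 > 0; cosh (4χ) ≥ (exp (4χ))/2 ≥ (4χ + 1)/2 > 2χ
  set χ : ℝ := a₀ / |a₁| + 1 with hχ
  have hχpos : 0 < χ := by positivity
  have hcosh : 2 * χ ≤ Real.cosh (4 * χ) := by
    rw [Real.cosh_eq]
    have e1 : 4 * χ + 1 ≤ Real.exp (4 * χ) := Real.add_one_le_exp _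
    have e2 : 0 < Real.exp (-(4 * χ)) := Real.exp_pos _
    linarith
  have hk := key χ
  have : |a₁| * (2 * χ) ≤ a₀ := le_trans (mul_le_mul_of_nonneg_left hcosh hpos.le) hk
  have hid : |a₁| * (2 * χ) = 2 * a₀ + 2 * |a₁| := by
    rw [hχ]; field_simp
  linarith
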